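import Summits.ResolutionOfSingularities.ResolutionOfSingularities.Theorems.PurelyInseparableDim4ResConeShearTransport
import Summits.ResolutionOfSingularities.ResolutionOfSingularities.Theorems.PurelyInseparableDim4ResConeTranslatedStepCoefficient
import Summits.ResolutionOfSingularities.ResolutionOfSingularities.Theorems.PurelyInseparableDim4FreeTail
import HarnessLib
import HarnessLib.Audit.Tags

/-!
# Purely inseparable four-folds — THE READINGS LAW OF A ONE-LETTER TRANSLATED STEP (L-edition, «L-LIGHT» brick): the row / Hasse-derivative
# vanishing forced by the regime, and the TOP φ-COMPONENT of a bi-slice along a single-chart run (cell `res-dim4-pi`, K2(p) lane)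

[OURS · counted 0 · cell `res-dim4-pi` · K2(p) lane holder res-dim4-p-12 g5, ruling g5-31 (bus 2026-08-29T14:57:22Z) «LAST BRICK for p-5 g6: L-LIGHT —
the row-polynomial divisibility (READ-A / READ-B), no Tschirnhaus»; TEXT res-dim4-p-5 g6 `memo/L-LIGHT-CELL-g6.md` §1, §6; seat res-dim4-p-5 g6.]
Nothing here proves any TAIL(p, d, 3), K2(7), K2(p), `NoIsolatedTrap p p` or resolution of singularities in dimension ≥ 4 / characteristic `p` —
NOT proved; in particular the loss-free L-sector LIGHT-twin tail (holder's open cell) is NOT killed here.  Pure bookkeeping of ONE step and of a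
single-chart run of OUR frame.  AI kernel work, weaker than expert review.

THE LAW.  One point step in the `x_a`-chart at the chart point `t·e_{a′}` (`a′ ≠ a` the only translated letter; in a loss-free L-sector step `a` is a
twin and `a′ = φ` the free letter).  By `coeff_step_single_chartExponent` (res-dim4-p-5 g3) the child coefficient at the chart image of
`e = (…, e_a, …, e_{a′}, …)` is the ROW SUM `Σ_{l ≤ e_a} C(e_{a′} + l, l) t^l · coeff_{e − l·e_a + l·e_{a′}} F` — the `e_{a′}`-th Hasse derivative at
`t` of the row polynomial `R_ρ(x) = Σ_k coeff_{(ρ; k)} F · x^k` of the row `ρ` of `e` (all letters but `a, a′` and the degree fixed).  If the child is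
IN REGIME — every monomial of degree `≥ o`, the degree-`o` part a single monomial `X₀` (the L-sector: monomial residual cone, so «straight» is
automatic and no Tschirnhaus move is needed) — then every row sum whose image has degree `< o`, or `= o` with image `≠ X₀`, VANISHES:
* §1 **`coeff_eq_zero_of_regime`**, **`readings_vanish`** (state form, any `q`, any chart point `t·e_{a′}`), **`readings_vanish_of_degree_le`**
  (the image degree is `2|e| − q − e_a`, `degree_chartExponent_univ`; the cleaning never interferes when some letter `l ≠ a` has
  `0 < e_l`, `q ∤ e_l`);
* §2 **`readings_vanish_chain`** — the same along a witnessed `Step0` chain at a step `k` whose translation is supported on one letter `φ ≠ j k`.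
In the memo's words (READ-A): `(x − t)^{μ(ρ)} ∣ R_ρ(x)` with `μ(ρ) = s − n − 2m + 1` for the rows of parent degree `o + m`, `m ≥ 1`.
* §3 **THE TOP `a′`-COMPONENT OF A BI-SLICE NEVER CANCELS**: if `E ∈ supp F` has the largest `a′`-exponent among the monomials of `F` with the same
  exponents off `{a, a′}` (its BI-SLICE; the degree is free), then `E` is canceller-free, its chart image is a monomial of the child with the
  same property (**`bisliceTop_step`**), and its degree moves by `(Σ_{l ≠ a} E_l) − q` (**`degree_chartExponent_univ'`**).  Along a run of `T`
  consecutive steps charting `a` and translating only `a′` on a witnessed chain the images stay in the support, so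
  **`single_chart_run_bound`**: `T · q ≤ T · (Σ_{l ≠ a} E_l) + |E| − q` — a CONTRACTING top component (`Σ_{l ≠ a} E_l < q`) bounds the run
  («FT with a number»; FT itself is `chart_change_after`).
[cite: Hauser2010, §§F–G, §I (P⁺ = P(y + t·y_m))] [cite: HauserPerlega2019PRIMS, §2 (transform at a translated point)]
[cite: CossartJannsenSaito2020, Thm. 3.14, Lemma 13.2]
bears_on: LADDER-RESOLUTION:D157-DOOR2 (res-dim4-pi · K2(p) · loss-free L-sector light cell · readings law, L-edition).
Supports stmt-ResolutionOfSingularities-16155 (helper).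
-/

set_option linter.dupNamespace false -- mandated namespace of this single-conjunct summit

noncomputable section

namespace Summit.ResolutionOfSingularities.ResolutionOfSingularities.Theorems.PIDim4

namespace ResCone

open MvPolynomial Finset
open Literature.AlgebraicGeometry.Resolution
open Literature.AlgebraicGeometry.Resolution.CentreBlowup
open Literature.AlgebraicGeometry.Resolution.Hauser2010
open Literature.AlgebraicGeometry.Resolution.HauserPerlega2019

variable {K : Type} [Field K]

/-! ## 1. The readings law of one step (state form) -/

section Readings

/-- IN REGIME ⇒ VANISHING: if every monomial of `G` has degree `≥ o` and the only one of degree `o` is `X₀`, then the coefficient of `G` at any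
`X` of degree `< o`, or of degree `o` but `≠ X₀`, is `0`. [folklore] -/
theorem coeff_eq_zero_of_regime {G : MvPolynomial (Fin 4) K} {o : ℕ} {X₀ X : Fin 4 →₀ ℕ}
    (hreg : ∀ Y ∈ G.support, o ≤ Y.degree ∧ (Y.degree = o → Y = X₀))
    (hX : X.degree < o ∨ (X.degree = o ∧ X ≠ X₀)) : coeff X G = 0 := by
  by_contra h
  obtain ⟨hle, heq⟩ := hreg X (MvPolynomial.mem_support_iff.mpr h)
  rcases hX with hlt | ⟨hdeg, hne⟩
  · omega
  · exact hne (heq hdeg)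

variable [DecidableEq K]

/-- **THE READINGS LAW** (one point step in the `x_a`-chart at the chart point `t·e_{a′}`, `a′ ≠ a`, `q ≤ ord F`, `q ≤ |e|`): if the child is in
regime (degrees `≥ o`, the degree-`o` part the single monomial `X₀`) and the chart image of `e` has degree `< o` (or `= o` and is not `X₀`) and
is not deleted by the cleaning, then the ROW SUM of `e` vanishes:
`Σ_{l ≤ e_a} C(e_{a′} + l, l) · t^l · coeff_{e − l·e_a + l·e_{a′}} F = 0` — the `e_{a′}`-th Hasse derivative of the row polynomial at `t`.
[OURS · bookkeeping] [cite: HauserPerlega2019PRIMS, §2 (transform at a translated point)] [cite: Hauser2010, §I] -/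
theorem readings_vanish (q : ℕ) {a a' : Fin 4} (haa : a ≠ a') (t : K) (s : State K)
    (hq : (q : ℕ∞) ≤ ordAlong Finset.univ s.F) {o : ℕ} {X₀ : Fin 4 →₀ ℕ}
    (hreg : ∀ Y ∈ (CentreBlowup.step q Finset.univ a (Pi.single a' t) s).F.support, o ≤ Y.degree ∧ (Y.degree = o → Y = X₀))
    {e : Fin 4 →₀ ℕ} (he : q ≤ e.degree)
    (hlow : (chartExponent q Finset.univ a e).degree < o ∨
      ((chartExponent q Finset.univ a e).degree = o ∧ chartExponent q Finset.univ a e ≠ X₀))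
    (hnp : ¬ IsPthPowerExponent q (chartExponent q Finset.univ a e)) :
    ∑ l ∈ Finset.range (e a + 1),
      ((e a' + l).choose l : K) * t ^ l * coeff ((e.update a (e a - l)).update a' (e a' + l)) s.F = 0 := by
  have h0 := coeff_eq_zero_of_regime hreg hlow
  rw [coeff_step_single_chartExponent q haa t s hq he, if_neg hnp] at h0
  exact h0

omit [Field K] [DecidableEq K] in
/-- The cleaning never touches a chart image one of whose off-chart letters carries an exponent not divisible by `q`. [folklore] -/
theorem not_isPthPowerExponent_chartExponent_of_not_dvd (q : ℕ) {a l : Fin 4} (hla : l ≠ a) {e : Fin 4 →₀ ℕ}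
    (hl0 : e l ≠ 0) (hnd : ¬ q ∣ e l) : ¬ IsPthPowerExponent q (chartExponent q Finset.univ a e) := by
  intro h
  have happ : chartExponent q Finset.univ a e l = e l := chartExponent_apply_of_ne q _ hla e
  refine hnd ?_
  rw [← happ]
  exact h l (Finsupp.mem_support_iff.mpr (by rw [happ]; exact hl0))

omit [Field K] [DecidableEq K] in
/-- Degree of the chart image in subtraction-free form: `|e′| = 2|e| − q − e_a`, i.e. `|e′| + q + e_a = 2|e|` (`q ≤ |e|`). [folklore] -/
theorem degree_chartExponent_univ' (q : ℕ) (a : Fin 4) {e : Fin 4 →₀ ℕ} (he : q ≤ e.degree) :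
    (chartExponent q Finset.univ a e).degree + q = e.degree + ∑ l ∈ Finset.univ.erase a, e l := by
  have h1 := degree_chartExponent_univ q a he
  have h2 := sum_erase_add_apply_eq_degree a e
  omega

/-- **THE READINGS LAW, DEGREE FORM** (the L-edition used in the memo): with the image degree `2|e| − q − e_a`, the row sum of `e` vanishes as
soon as `2|e| ≤ o + q + e_a`, the image differs from `X₀` in the chart letter (`|e| − q ≠ X₀ a`, automatic off the initial row), and some letter
`l ≠ a` has `0 < e_l`, `q ∤ e_l` (no cleaning).  [OURS · bookkeeping] [cite: HauserPerlega2019PRIMS, §2] -/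
theorem readings_vanish_of_degree_le (q : ℕ) {a a' : Fin 4} (haa : a ≠ a') (t : K) (s : State K)
    (hq : (q : ℕ∞) ≤ ordAlong Finset.univ s.F) {o : ℕ} {X₀ : Fin 4 →₀ ℕ}
    (hreg : ∀ Y ∈ (CentreBlowup.step q Finset.univ a (Pi.single a' t) s).F.support, o ≤ Y.degree ∧ (Y.degree = o → Y = X₀))
    {e : Fin 4 →₀ ℕ} (he : q ≤ e.degree) (hdeg : 2 * e.degree ≤ o + q + e a) (hX₀ : e.degree ≠ X₀ a + q)
    {l : Fin 4} (hla : l ≠ a) (hl0 : e l ≠ 0) (hnd : ¬ q ∣ e l) :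
    ∑ l ∈ Finset.range (e a + 1),
      ((e a' + l).choose l : K) * t ^ l * coeff ((e.update a (e a - l)).update a' (e a' + l)) s.F = 0 := by
  refine readings_vanish q haa t s hq hreg he ?_ (not_isPthPowerExponent_chartExponent_of_not_dvd q hla hl0 hnd)
  have h1 := degree_chartExponent_univ q a he
  have hself : chartExponent q Finset.univ a e a = e.degree - q := chartExponent_univ_apply_self q a e
  by_cases hlt : (chartExponent q Finset.univ a e).degree < o
  · exact Or.inl hlt
  · refine Or.inr ⟨by omega, fun hX => hX₀ ?_⟩
    have h2 : X₀ a = e.degree - q := by rw [← hX, hself]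
    omega

end Readings

/-! ## 2. The readings law along a witnessed chain -/

section Chain

variable [DecidableEq K]

omit [Field K] [DecidableEq K] in
/-- A translation supported on one letter `φ` is `Pi.single φ (b φ)`. [folklore] -/
theorem eq_single_of_forall_ne_eq_zero [Zero K] {b : Fin 4 → K} {φ : Fin 4} (hb : ∀ l, l ≠ φ → b l = 0) :
    b = Pi.single φ (b φ) := by
  funext l
  by_cases h : l = φ
  · subst h; rw [Pi.single_eq_same]
  · rw [Pi.single_eq_of_ne h]; exact hb l h

/-- **THE READINGS LAW ALONG A WITNESSED CHAIN**: at a step `k` of a witnessed `Step0 p` chain whose translation is supported on ONE letter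
`φ ≠ j k` (a loss-free L-sector step: `j k` a twin, `φ` the free letter), if `c (k+1)` is in regime (degrees `≥ o`, degree-`o` part the monomial
`X₀`) then every row sum of `(c k).F` whose image is low (degree `< o`, or `= o` and `≠ X₀`) and uncleaned vanishes. [OURS · bookkeeping]
[cite: HauserPerlega2019PRIMS, §2 (transform at a translated point)] [cite: CossartJannsenSaito2020, Thm. 3.14] -/
theorem readings_vanish_chain (p : ℕ) {c : ℕ → State K} {j : ℕ → Fin 4} {b : ℕ → Fin 4 → K}
    (hw : FreeTail.IsWitnessedChain p c j b) (k : ℕ) {φ : Fin 4} (hφ : φ ≠ j k) (hb : ∀ l, l ≠ φ → b k l = 0)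
    {o : ℕ} {X₀ : Fin 4 →₀ ℕ} (hreg : ∀ Y ∈ (c (k + 1)).F.support, o ≤ Y.degree ∧ (Y.degree = o → Y = X₀))
    {e : Fin 4 →₀ ℕ} (he : p ≤ e.degree)
    (hlow : (chartExponent p Finset.univ (j k) e).degree < o ∨
      ((chartExponent p Finset.univ (j k) e).degree = o ∧ chartExponent p Finset.univ (j k) e ≠ X₀))
    (hnp : ¬ IsPthPowerExponent p (chartExponent p Finset.univ (j k) e)) :
    ∑ l ∈ Finset.range (e (j k) + 1),
      ((e φ + l).choose l : K) * b k φ ^ l * coeff ((e.update (j k) (e (j k) - l)).update φ (e φ + l)) (c k).F = 0 := by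
  obtain ⟨hq, -, -, -, hstep⟩ := hw k
  have hbs := eq_single_of_forall_ne_eq_zero hb
  rw [hstep, hbs] at hreg
  exact readings_vanish p hφ.symm (b k φ) (c k) hq hreg he hlow hnp

/-- **Chain edition, degree form.** [OURS · bookkeeping] [cite: HauserPerlega2019PRIMS, §2] -/
theorem readings_vanish_chain_of_degree_le (p : ℕ) {c : ℕ → State K} {j : ℕ → Fin 4} {b : ℕ → Fin 4 → K}
    (hw : FreeTail.IsWitnessedChain p c j b) (k : ℕ) {φ : Fin 4} (hφ : φ ≠ j k) (hb : ∀ l, l ≠ φ → b k l = 0)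
    {o : ℕ} {X₀ : Fin 4 →₀ ℕ} (hreg : ∀ Y ∈ (c (k + 1)).F.support, o ≤ Y.degree ∧ (Y.degree = o → Y = X₀))
    {e : Fin 4 →₀ ℕ} (he : p ≤ e.degree) (hdeg : 2 * e.degree ≤ o + p + e (j k)) (hX₀ : e.degree ≠ X₀ (j k) + p)
    {l : Fin 4} (hla : l ≠ j k) (hl0 : e l ≠ 0) (hnd : ¬ p ∣ e l) :
    ∑ l ∈ Finset.range (e (j k) + 1),
      ((e φ + l).choose l : K) * b k φ ^ l * coeff ((e.update (j k) (e (j k) - l)).update φ (e φ + l)) (c k).F = 0 := by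
  obtain ⟨hq, -, -, -, hstep⟩ := hw k
  have hbs := eq_single_of_forall_ne_eq_zero hb
  rw [hstep, hbs] at hreg
  exact readings_vanish_of_degree_le p hφ.symm (b k φ) (c k) hq hreg he hdeg hX₀ hla hl0 hnd

end Chain

/-! ## 3. The top `a′`-component of a bi-slice along a single-chart run -/

section BiSlice

variable [DecidableEq K]

omit [DecidableEq K] in
/-- `E` is the TOP of its bi-slice in `F` (w.r.t. the chart letter `a` and the translated letter `a′`): every monomial of `F` with the same
exponents off `{a, a′}` has `a′`-exponent `≤ E_{a′}` — spelled out inline (no definition). A bi-slice top is CANCELLER-FREE in the sense of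
`…TranslatedStepWitness`. [OURS · bookkeeping] -/
theorem forall_not_canceller_of_bisliceTop {a a' : Fin 4} (haa : a ≠ a') (t : K) (F : MvPolynomial (Fin 4) K) {E : Fin 4 →₀ ℕ}
    (htop : ∀ m ∈ F.support, (∀ l, l ≠ a → l ≠ a' → m l = E l) → m a' ≤ E a') :
    ∀ m ∈ F.support, m.degree = E.degree → (∀ i, i ≠ a → (Pi.single a' t : Fin 4 → K) i = 0 → m i = E i) →
      (∀ i, i ≠ a → E i ≤ m i) → m = E := by
  intro m hm hdeg hkept hle
  have hoff : ∀ l, l ≠ a → l ≠ a' → m l = E l := fun l hla hla' =>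
    hkept l hla (by rw [Pi.single_eq_of_ne hla'])
  have ha' : m a' = E a' := le_antisymm (htop m hm hoff) (hle a' haa.symm)
  have hall : ∀ l, l ≠ a → m l = E l := fun l hla => by
    by_cases hla' : l = a'
    · rw [hla']; exact ha'
    · exact hoff l hla hla'
  have hsum : ∑ l ∈ Finset.univ.erase a, m l = ∑ l ∈ Finset.univ.erase a, E l :=
    Finset.sum_congr rfl fun l hl => hall l (Finset.ne_of_mem_erase hl)
  have h1 := sum_erase_add_apply_eq_degree a m
  have h2 := sum_erase_add_apply_eq_degree a E
  have ha : m a = E a := by omega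
  ext l
  by_cases hla : l = a
  · rw [hla]; exact ha
  · exact hall l hla

/-- **THE TOP COMPONENT SURVIVES ONE STEP AND STAYS ON TOP** (chart `a`, chart point `t·e_{a′}`, `q ≤ ord F`): if `E ∈ supp F` is the top of
its bi-slice and its image is not cleaned, then the image `E′ = chartExponent q univ a E` is a monomial of the child and is again the top of
its bi-slice there (every child monomial with the same exponents off `{a, a′}` descends from `E`'s bi-slice and has lost `a′`-mass only).
[OURS · bookkeeping] [cite: Hauser2010, §I] [cite: HauserPerlega2019PRIMS, §2] -/
theorem bisliceTop_step (q : ℕ) {a a' : Fin 4} (haa : a ≠ a') (t : K) (s : State K)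
    (hq : (q : ℕ∞) ≤ ordAlong Finset.univ s.F) {E : Fin 4 →₀ ℕ} (hEF : E ∈ s.F.support)
    (htop : ∀ m ∈ s.F.support, (∀ l, l ≠ a → l ≠ a' → m l = E l) → m a' ≤ E a')
    (hnp : ¬ IsPthPowerExponent q (chartExponent q Finset.univ a E)) :
    chartExponent q Finset.univ a E ∈ (CentreBlowup.step q Finset.univ a (Pi.single a' t) s).F.support ∧
      ∀ Y ∈ (CentreBlowup.step q Finset.univ a (Pi.single a' t) s).F.support,
        (∀ l, l ≠ a → l ≠ a' → Y l = chartExponent q Finset.univ a E l) → Y a' ≤ chartExponent q Finset.univ a E a' := by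
  have hE : q ≤ E.degree := le_degree_of_mem_support hq hEF
  refine ⟨chartExponent_mem_support_step_of_forall_not_canceller q a (by rw [Pi.single_eq_of_ne haa]) s hq hEF hE
      (forall_not_canceller_of_bisliceTop haa t s.F htop) hnp, fun Y hY hoff => ?_⟩
  obtain ⟨m, hm, l, hl, hmY⟩ := exists_of_mem_support_step_single q haa t s hq hY
  rw [chartExponent_apply_of_ne q _ haa.symm E]
  have hYa' : Y a' = m a' - l := by
    rw [← hmY, chartExponent_apply_of_ne q _ haa.symm, shear_target_apply haa m l a', if_neg haa.symm, if_pos rfl]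
  have hmoff : ∀ l', l' ≠ a → l' ≠ a' → m l' = E l' := fun l' hla hla' => by
    have h1 := hoff l' hla hla'
    rw [← hmY, chartExponent_apply_of_ne q _ hla, shear_target_apply haa m l l', if_neg hla, if_neg hla',
      chartExponent_apply_of_ne q _ hla E] at h1
    exact h1
  have h2 := htop m hm hmoff
  omega

/-- **SINGLE-CHART RUN BOUND** («FT with a number» for a contracting top component): along a witnessed `Step0 p` chain, suppose the steps
`k₀, …, k₀ + T − 1` all chart the letter `a` and translate only the letter `a′ ≠ a`, and `E ∈ supp F_{k₀}` is the top of its bi-slice with some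
letter `l ≠ a` carrying `0 < E_l`, `p ∤ E_l`.  Then the `T`-th image of `E` is still a monomial (of degree `|E| + T·((Σ_{l ≠ a} E_l) − p)`), so
`T · p ≤ T · (Σ_{l ≠ a} E_l) + |E| − p`: a bi-slice top with `Σ_{l ≠ a} E_l < p` bounds the length of the run. [OURS]
[cite: CossartJannsenSaito2020, Thm. 3.14, Lemma 13.2] [cite: HauserPerlega2019PRIMS, §2] -/
theorem single_chart_run_bound (p : ℕ) {c : ℕ → State K} {j : ℕ → Fin 4} {b : ℕ → Fin 4 → K}
    (hw : FreeTail.IsWitnessedChain p c j b) {a a' : Fin 4} (haa : a ≠ a') (k₀ T : ℕ)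
    (hrun : ∀ i, i < T → j (k₀ + i) = a ∧ ∀ l, l ≠ a' → b (k₀ + i) l = 0)
    {E : Fin 4 →₀ ℕ} (hEF : E ∈ (c k₀).F.support)
    (htop : ∀ m ∈ (c k₀).F.support, (∀ l, l ≠ a → l ≠ a' → m l = E l) → m a' ≤ E a')
    {l : Fin 4} (hla : l ≠ a) (hl0 : E l ≠ 0) (hnd : ¬ p ∣ E l) :
    T * p + p ≤ T * (∑ l ∈ Finset.univ.erase a, E l) + E.degree := by
  -- the invariant carried along the run: an image monomial with the same off-`a` exponents and shifted degree, on top of its bi-slice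
  have key : ∀ i, i ≤ T → ∃ X ∈ (c (k₀ + i)).F.support, (∀ l, l ≠ a → X l = E l) ∧
      X.degree + i * p = E.degree + i * (∑ l ∈ Finset.univ.erase a, E l) ∧
      (∀ m ∈ (c (k₀ + i)).F.support, (∀ l, l ≠ a → l ≠ a' → m l = X l) → m a' ≤ X a') := by
    intro i hi
    induction i with
    | zero => exact ⟨E, by simpa using hEF, fun l _ => rfl, by simp, by simpa using htop⟩
    | succ i ih =>
      obtain ⟨X, hX, hoffX, hdegX, htopX⟩ := ih (Nat.le_of_succ_le hi)
      obtain ⟨hja, hbi⟩ := hrun i hi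
      obtain ⟨hq, -, -, -, hstep⟩ := hw (k₀ + i)
      have hbs := eq_single_of_forall_ne_eq_zero hbi
      have hXl0 : X l ≠ 0 := by rw [hoffX l hla]; exact hl0
      have hXnd : ¬ p ∣ X l := by rw [hoffX l hla]; exact hnd
      have hnp := not_isPthPowerExponent_chartExponent_of_not_dvd p hla hXl0 hXnd
      rw [hja] at hstep
      rw [hbs] at hstep
      obtain ⟨hmem, htop'⟩ := bisliceTop_step p haa (b (k₀ + i) a') (c (k₀ + i)) hq hX htopX hnp
      have hXdeg : p ≤ X.degree := le_degree_of_mem_support hq hX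
      have hd := degree_chartExponent_univ' p a hXdeg
      have hsum : ∑ l ∈ Finset.univ.erase a, X l = ∑ l ∈ Finset.univ.erase a, E l :=
        Finset.sum_congr rfl fun l hl => hoffX l (Finset.ne_of_mem_erase hl)
      refine ⟨chartExponent p Finset.univ a X, ?_, fun l' hla' => ?_, ?_, ?_⟩
      · rw [Nat.add_succ, hstep]; exact hmem
      · rw [chartExponent_apply_of_ne p _ hla', hoffX l' hla']
      · rw [Nat.succ_mul, Nat.succ_mul]; omega
      · rw [Nat.add_succ, hstep]; exact htop'
  obtain ⟨X, hX, -, hdegX, -⟩ := key T le_rfl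
  obtain ⟨hq, -, -, -, -⟩ := hw (k₀ + T)
  have hXdeg : p ≤ X.degree := le_degree_of_mem_support hq hX
  nlinarith [hXdeg, hdegX]

end BiSlice

end ResCone

end Summit.ResolutionOfSingularities.ResolutionOfSingularities.Theorems.PIDim4

end
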